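import Literature.MathematicalPhysics.QuantumFieldTheory.Balaban1983to89.T4AdjointCovariance

/-!
# Bałaban 1983–89, node O3.E-i′ (α), the A-field half — the WORDS: the axial-gauge elimination map `C`,
# the operator `Δ₁` of the quadratic form (1.16), the word `C*Δ₁C`, the conditional covariance `C^{(0)}(Λ)`
# and the completed square of (1.26), typed as covariant blocks over `T4AdjointCovariance`

(cell `pub-balaban`, self-proposed row T4-O3.E-i′-Oα-Ad-WORDS*; structural discharge of GAPS G-pv04g7-1 = NOT CLAIMED
(i) of `T4AdjointCovariance`: «typed CONSTRUCTION of Δ₁/Δ^{(j)}, C, C^{(0)}(Λ₁)/C^{(j)}(Λ_{j+1}) as words in covariant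
blocks»; kernel bookkeeping, NOT summit progress.)

HONEST FRAMING.  The cell's T4 target is the existence and uniqueness of the continuum limit of Bałaban's unit-scale
averaged loop expectations on a finite torus; it is NOT the Yang–Mills mass gap and NOT the Clay problem.  This
module proves NO estimate and NO statement of the papers.  `T4AdjointCovariance` typed the printed symmetry sentence
(invariance under the simultaneous transformation U₁ → U₁^u, A → R(u)A, (1.17)) and left every operator of the papers
as an abstract family whose covariance `OpCovariant …` is a HYPOTHESIS.  This leaf removes the part of that hypothesis
that is pure finite-dimensional linear algebra: it shows by which WORDS the objects C, Δ₁, C*Δ₁C, C^{(0)}(Λ₁) are built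
from more primitive data, and that each word-forming operation (unique solution of an invariant constraint; operator
of an invariant quadratic form; pairing-adjoint; composition; inverse of a strictly positive block; extension by
zero / restriction) PRESERVES covariance — so that the residual hypotheses are exactly the printed analytic inputs
(covariance of the linear averaging operator Q̃ = Q(U₁); invariance of the three summands of (1.16); strict positivity
of the Λ₁-block of C*Δ₁C), which are NOT proved here.

WHAT IS PRINTED (renders `b2b-balaban-ref1/pages/<stem>/…-pNNN-x2.png` read AS IMAGES by the author seat; journal
page = printed page, PDF page in brackets).

* (W1) [Balaban1988Convergent] (= B14, CMP 119:243) p. 249 [7], after (1.14): «Let us recall that the linearizing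
  transformation is different from the identity only on bonds {b₀(c) : c∈Ω₁⁽¹⁾}, … Also, let us recall that the
  functions and operators on the right-hand side of (1.14) depend on the configuration U₁. Now we perform the scaling
  transformation A = g₀A′ in the integral with respect to variables A, and we remove the δ-functions under the
  integral solving the equations (Q̃A′)(c) = 0 on Ω₁⁽¹⁾. The equation determines the variable A′(b₀(c)) as a linear
  function of the remaining variables A′(b), b⊂B(c₋)∪B(c₊), b ≠ b₀(c). We denote this function by C, and we denote by
  A the integration variables restricted to bonds Ω₁* = Ω₁∖{b₀(c) : c∈Ω₁⁽¹⁾}. Hence A′ = CA are solutions of the above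
  equations and we have Q̃CA = 0.»; (1.15) then carries «exp[−½⟨A, C*Δ₁CA⟩ + v(g₀CA) − (1/g₀²)V(g₀CA)]» and (1.16)
  reads «⟨A, Δ₁A⟩ = ⟨A, ΔA⟩ − 2⟨hC⁽²⁾(A), J₁⟩ + 𝐆⁽²⁾(A) ,».  The invariance sentence after (1.16)/(1.17) (p. 250
  [8]) and the display (1.26) (p. 253 [11]) with «dμ_{C^{(0)}(Λ₁)}», «exp[−½⟨Λ₁A, C*Δ₁CΛ₁A⟩ − ⟨Λ₁ᶜA, C*Δ₁CΛ₁A⟩ …]»,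
  «exp[log Z^{(0)}(Λ₁) + ½⟨Λ₁ᶜA, C*Δ₁CC^{(0)}(Λ₁)C*Δ₁CΛ₁ᶜA⟩ + 𝐄⁽¹⁾(Λ₁, g₀, Λ₁ᶜA)]», «The above equalities define the
  functions 𝐕⁽⁰⁾ and 𝐄⁽¹⁾. Let us recall that all the above expressions depend on the configuration U₁.» are quoted
  in full in `T4AdjointCovariance` (P1)–(P4) (same renders; GAPS C-pv04g7-1); p. 252 [10] → p. 253 introduces (1.26)
  by «For each term in this expansion consider the conditional integral with respect to the variables A restricted
  to Λ₁. This integral is equal to the corresponding conditional integral in the case analyzed in [I], i.e. where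
  there are no large field regions, but with a different background field. It is given by».
* (W2) [Balaban1985UV3] (= B10, CMP 102:255) p. 259 [5], (14)–(15): «(U′U₁)‾(Ū₁)⁻¹ = Ũ′ = Ū′ = exp iQ(A′), (14)
  where the second equality follows from the definition (89) (or (63)) in [4], and the gauge fixing conditions.
  Properties of the function Q(A′) = Q(U₁, A′) were described in Proposition 3 [4]. It is an analytic function of A′
  with the decomposition Q(A′) = QA′ + C(A′), (15) where Q = Q(U₁) is the linear averaging operator defined by
  (124) [4], and C(A′) is an analytic function with an expansion beginning with a second order polynomial.»; p. 260
  [6], (17): «QD̃(A, c) = C(A − D̃(A, c), c). Let us denote by b₀(c) the bond b∈B(c) and contained in c (let us recall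
  that B(c) is the set of bonds connecting the blocks B(c₋), B(c₊), i.e. the set of bonds b such that b₋∈B(c₋),
  b₊∈B(c₊)). We assume that D̃(A, b, c) = 0 for all b ≠ b₀(c). This assures the locality properties. … There exists a
  unique solution D̃ of this equation for A sufficiently small, and it is an analytic function of A with a Taylor
  expansion beginning with second order terms.»  (Only the LINEAR part — one dependent bond b₀(c) per cube c, solved
  for from the c-th linear equation — is typed below; D̃ and C(A′) of (15) are not.)
* (W3) [Balaban1985BackgroundPropagators] (= B9, CMP 99:389) p. 395 [7], (3.30): «⟨R(u)A, J^u⟩ = ⟨A, J⟩,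
  ⟨R(u)A, Δ^η(U^u)R(u)A⟩ = ⟨A, Δ^η(U)A⟩, (3.30) or J^u = R(u)J, Δ^η(U^u) = R(u)Δ^η(U)R(u^{−1}).» (quoted in full in
  `T4AdjointCovariance` (P5)) — the printed INFERENCE from the invariance of a quadratic form to the covariance of its
  operator, which §3 proves for any additive pairing-symmetric family.

READING (labelled as such, not printed in these words).  (R1) The linear system «(Q̃A′)(c) = 0 on Ω₁⁽¹⁾» is typed in
SPLIT FORM `linConstraint`: (Q̃x)(c) = (Q_f x|_{Ω₁*})(c) + M(c)·x(b₀(c)) — the c-th equation contains exactly one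
dependent variable, its own x(b₀(c)), with an invertible coefficient M(c) (this is what «The equation determines the
variable A′(b₀(c)) as a linear function of the remaining variables» says equation by equation; (W2) fixes b₀(c) ⊂ c);
the free part Q_f = Q_f(U₁) is an abstract family, NOT the operator (124) [4].  The abstract §1 covers any splitting
with an invertible dependent block.  (R2) Δ₁ is read as the additive, ⟨·,·⟩-symmetric operator whose quadratic form is
the right-hand side of (1.16); h, C⁽²⁾, J₁, 𝐆⁽²⁾, Δ are not typed.  (R3) C^{(0)}(Λ₁) is read, by the standard
Gaussian dictionary ∫dA e^{−½⟨A,MA⟩}F = Z∫dμ_{M^{−1}}F, as the inverse of the Λ₁-block M = Λ₁(C*Δ₁C)Λ₁ on the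
Λ₁-supported fields (the first exponent of (1.26)), placed inside words as restrict–invert–extend-by-zero (`condCov`);
the Gaussian integral itself is not formalised.  (R4) As in `T4AdjointCovariance` (R1)/(R3): constant u ≡ g, abstract
`Ad : G → (V ≃ₗᵢ[ℝ] V)`; scale-j objects of (2.21) are identified with first-step ones only through B14 p. 257 (P4).

WHAT THE KERNEL PROVES (every declaration [folklore] unless its docstring carries a [cite:] LOCATOR of the printed
words whose SHAPE it types — a [cite:] here never asserts a result of the paper).
* §1 (abstract): a map characterised as the UNIQUE solution of a jointly invariant condition is a covariant family
  (`opCovariant_of_unique`); hence the solution operator of a covariant constraint with prescribed free part is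
  covariant (`opCovariant_of_constraint`); the operator representing a jointly invariant form is covariant
  (`opCovariant_of_invariant_form`); and the ELIMINATION MODEL `solveC glue Qf QdInv` (glue the free variables to the
  dependent ones solved through an invertible dependent block): free part = id, solves the constraint, UNIQUE, additive
  / homogeneous, covariant given covariance of the full constraint (`res_solveC`, `constraint_solveC`,
  `solveC_unique`, `solveC_add`, `solveC_smul`, `opCovariant_solveC`).
* §2 (lattice): the coordinate splitting along the free set Ω₁* (`freePart`, `depPart`, `glueParts`, their algebra and
  equivariance under `adAct`); the one-bond-per-cube dependent block `depBlock S e M` with e : cubes ≃ dependent bonds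
  and invertible coefficients M ω c : V ≃ₗ[ℝ] V, its two-sided inverse `depBlockInv`; the split constraint
  `linConstraint` (R1) and the map `axialC` = C: `freePart_axialC` («A′ = CA» extends A), `axialC_apply_dep`
  (A′(b₀(c)) = −M(c)⁻¹(Q_f A)(c), «a linear function of the remaining variables»), `linConstraint_axialC` («Q̃CA = 0»),
  `axialC_unique` / `existsUnique_linConstraint` («The equation determines …»), `axialC_add` / `axialC_smul`, and
  `opCovariant_axialC`: C(U₁^u)R(u) = R(u)C(U₁) GIVEN `OpCovariant` of the full constraint Q̃(U₁) (hypothesis).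
* §3 (pairing): bilinearity / symmetry of `pairSum`, polarization, and `opCovariant_of_invariant_quadForm`: an additive
  pairing-symmetric family whose QUADRATIC FORM is jointly invariant is covariant — (W3) read left to right; for Δ₁ of
  (1.16) the invariance of the form is the printed sentence (P1), so Δ₁ (reading (R2)) is covariant; the pairing-adjoint
  of a covariant family is covariant with `pairSum`'s separation / `adAct`'s surjectivity discharged
  (`opCovariant_pairAdjoint`), hence the word «C*Δ₁C» is covariant (`opCovariant_CstarDeltaC`).
* §4 (block): for a linear family X(ω) on all fields and a region Λ, the Λ-block `blockOp Λ X ω = Λ X(ω) Λ` on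
  `↥Λ → V`; under STRICT POSITIVITY of the block (`BlockPos`, implied by strict positivity of X, `blockPos_of_pos`) it
  is injective hence — `↥Λ → V` being finite-dimensional — invertible: `blockInv` = C^{(0)}(Λ) EXISTS
  (`blockOp_blockInv`, `blockInv_blockOp`), is covariant (`opCovariant_blockInv`, via `OpCovariant.inverse`), symmetric
  when X is (`blockInv_symm`) and strictly positive (`blockInv_pos`); its placement on all fields `condCov` =
  Λ C^{(0)}(Λ) Λ is Λ-supported, sees only Λ-data, inverts X on Λ (`restrictTo_X_condCov`, `condCov_X_glueParts`), is
  covariant (`opCovariant_condCov`), symmetric (`condCov_symm`) and positive semidefinite (`condCov_nonneg`); and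
  COMPLETING THE SQUARE (`complete_square`): −½⟨ΛA, XΛA⟩ − ⟨B, XΛA⟩ = −½⟨a + C0ΛXB, M(a + C0ΛXB)⟩ +
  ½⟨B, X·condCov(XB)⟩ — the algebra producing the printed factor «½⟨Λ₁ᶜA, C*Δ₁CC^{(0)}(Λ₁)C*Δ₁CΛ₁ᶜA⟩» of (1.26).

NOT CLAIMED / NOT DONE.  (i) The linear averaging operator Q = Q(U₁) of (124) [4] / its free part Q_f, the operators
Δ, h, C⁽²⁾, J₁, 𝐆⁽²⁾ of (1.16), and hence Δ₁ and C*Δ₁C as concrete operators are NOT constructed; their covariance /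
invariance / symmetry / additivity and the strict positivity of the Λ₁-block are HYPOTHESES where used (printed
warrants: (P1) of `T4AdjointCovariance`, (W3), and the positivity bounds of the propagator papers — none proved here).
(ii) The existence of the pairing-adjoint C* is not constructed (finite-dimensional linear algebra; it enters
`opCovariant_CstarDeltaC` through the adjoint relation `hadj`).  (iii) No Gaussian integral, normalisation Z^{(0)}(Λ₁),
𝐕⁽⁰⁾, 𝐄⁽¹⁾, no measure theory at all in this leaf (reading (R3) is a dictionary, `complete_square` is its algebraic
half).  (iv) The non-linear objects D̃ (B10 (17)), C(A′) (B10 (15)), the δ-functions and z⁽⁰⁾ are untouched.  (v) That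
b₀(c′) for c′ ≠ c does not occur in the c-th equation (diagonal dependent block, reading (R1)) is a modelling choice
justified by (W2) «contained in c» + locality «depends on A restricted to B(c₋)∪B(c₊)», not a quoted statement; the
abstract §1 does not need it.  Value = typed skeleton + kernel bookkeeping, NOT summit progress.
-/

open scoped BigOperators

namespace Literature.MathematicalPhysics.QuantumFieldTheory.Balaban1983to89.T4AdjointCovarianceWords

open T4NestedCovariance T4AdjointCovariance

/-! ## §1  Abstract level: maps characterised by jointly invariant conditions are covariant -/

section Abstract

variable {G : Type*} {Ω : Type*} {E : Type*} {F : Type*} {W : Type*}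
variable {ρ : G → Ω → Ω} {σ : G → E → E} {τ : G → F → F} {υ : G → W → W}

/-- UNIQUE SOLUTIONS OF INVARIANT PROBLEMS ARE COVARIANT.  If `T ω a` is characterised as the unique `x` with
`P ω a x`, and the condition `P` is transported by the simultaneous transformation
(`P ω a x → P (ρ g ω) (σ g a) (τ g x)`),
then `T` is a covariant family.  This is the mechanism behind the covariance of every object the papers define by
"the equation determines … uniquely" (the map C of B14 p. 249, the function D̃ of B10 (17), minimisers). [folklore] -/
theorem opCovariant_of_unique {P : Ω → E → F → Prop} {T : Ω → E → F}
    (hP : ∀ g ω a x, P ω a x → P (ρ g ω) (σ g a) (τ g x))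
    (hsol : ∀ ω a, P ω a (T ω a)) (huniq : ∀ ω a x y, P ω a x → P ω a y → x = y) :
    OpCovariant ρ σ τ T := fun g ω a =>
  huniq (ρ g ω) (σ g a) _ _ (hsol (ρ g ω) (σ g a)) (hP g ω a (T ω a) (hsol ω a))

/-- THE SOLUTION OPERATOR OF A COVARIANT CONSTRAINT WITH PRESCRIBED FREE VARIABLES IS COVARIANT: if `Qt ω` (the
linearised averaging constraint «(Q̃A′)(c) = 0 on Ω₁⁽¹⁾», Q̃ = Q(U₁) background-dependent) is a covariant family with
`υ g 0 = 0`, the restriction `res` to the free variables («the integration variables restricted to bonds Ω₁*»)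
intertwines the actions, and `C ω a` is THE solution of `Qt ω x = 0` with free part `a`, then `C` is covariant:
C(U₁^u)R(u) = R(u)C(U₁).  Hypotheses only; the unique solvability is discharged for the elimination model below
and its lattice instance (§2). [cite: Balaban1988Convergent, p.249 (def. of C)] -/
theorem opCovariant_of_constraint [Zero W] (hυ : ∀ g, υ g (0 : W) = 0)
    {res : F → E} (hres : ∀ g x, res (τ g x) = σ g (res x))
    {Qt : Ω → F → W} (hQ : OpCovariant ρ τ υ Qt)
    {C : Ω → E → F} (hfree : ∀ ω a, res (C ω a) = a) (hsolves : ∀ ω a, Qt ω (C ω a) = 0)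
    (huniq : ∀ ω a x, res x = a → Qt ω x = 0 → x = C ω a) : OpCovariant ρ σ τ C :=
  opCovariant_of_unique (P := fun ω a x => res x = a ∧ Qt ω x = 0)
    (fun g ω a x h => ⟨by rw [hres, h.1], by rw [hQ g ω x, h.2, hυ]⟩)
    (fun ω a => ⟨hfree ω a, hsolves ω a⟩)
    (fun ω a x y hx hy => by rw [huniq ω a x hx.1 hx.2, huniq ω a y hy.1 hy.2])

/-- THE OPERATOR OF A JOINTLY INVARIANT FORM IS COVARIANT: if `BF x (T ω a) = Φ ω x a` represents a form `Φ` that is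
invariant under the simultaneous transformation, for an invariant pairing `BF` separating points and an onto target
action, then `T (ρ g ω) (σ g a) = τ g (T ω a)`.  (The dual of `T4AdjointCovariance.invariant_pairing`.) [folklore] -/
theorem opCovariant_of_invariant_form {R : Type*} {BF : F → F → R} {Φ : Ω → F → E → R} {T : Ω → E → F}
    (hrep : ∀ ω x a, BF x (T ω a) = Φ ω x a) (hΦ : ∀ g ω x a, Φ (ρ g ω) (τ g x) (σ g a) = Φ ω x a)
    (hBF : ∀ g x y, BF (τ g x) (τ g y) = BF x y) (hτ : ∀ g, Function.Surjective (τ g))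
    (hsep : ∀ y y' : F, (∀ x, BF x y = BF x y') → y = y') :
    OpCovariant ρ σ τ T := fun g ω a => by
  apply hsep
  intro z
  obtain ⟨x, rfl⟩ := hτ g z
  rw [hrep, hΦ, hBF, hrep]

/-! ### The abstract elimination model: free / dependent splitting, an invertible dependent block -/

section Elimination

variable {D : Type*}

/-- THE ELIMINATION MAP: glue the free variables `a` to the dependent variables solved from the constraint,
`dep = Qd⁻¹(−Qf a)` — «The equation determines the variable A′(b₀(c)) as a linear function of the remaining variables
… We denote this function by C».  Data: `glue : E → D → F` (reassemble a configuration from its free and dependent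
parts), `Qf ω : E → W` (the constraint applied to the free part), `QdInv ω : W → D` (inverse of the dependent block).
[cite: Balaban1988Convergent, p.249 (def. of C)] -/
def solveC [Neg W] (glue : E → D → F) (Qf : Ω → E → W) (QdInv : Ω → W → D) : Ω → E → F :=
  fun ω a => glue a (QdInv ω (-Qf ω a))

variable [AddCommGroup W] {res : F → E} {dep : F → D} {glue : E → D → F}
  {Qt : Ω → F → W} {Qf : Ω → E → W} {Qd : Ω → D → W} {QdInv : Ω → W → D}

/-- `solveC` on an argument. [folklore] -/
theorem solveC_apply (ω : Ω) (a : E) : solveC glue Qf QdInv ω a = glue a (QdInv ω (-Qf ω a)) := rfl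

/-- The free part of `C a` is `a`: «A′ = CA» extends the free variables A.
[cite: Balaban1988Convergent, p.249 (def. of C)] -/
theorem res_solveC (hrg : ∀ a d, res (glue a d) = a) (ω : Ω) (a : E) : res (solveC glue Qf QdInv ω a) = a :=
  hrg a _

/-- The dependent part of `C a` is the solved value `Qd⁻¹(−Qf a)`. [folklore] -/
theorem dep_solveC (hdg : ∀ a d, dep (glue a d) = d) (ω : Ω) (a : E) :
    dep (solveC glue Qf QdInv ω a) = QdInv ω (-Qf ω a) :=
  hdg a _

/-- `C a` SOLVES THE CONSTRAINT: «we have Q̃CA = 0», for a constraint splitting as `Qt x = Qf (res x) + Qd (dep x)`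
with `Qd ∘ Qd⁻¹ = id`. [cite: Balaban1988Convergent, p.249 (def. of C)] -/
theorem constraint_solveC (hQt : ∀ ω x, Qt ω x = Qf ω (res x) + Qd ω (dep x))
    (hrg : ∀ a d, res (glue a d) = a) (hdg : ∀ a d, dep (glue a d) = d)
    (hinv₁ : ∀ ω w, Qd ω (QdInv ω w) = w) (ω : Ω) (a : E) : Qt ω (solveC glue Qf QdInv ω a) = 0 := by
  rw [hQt, res_solveC hrg, dep_solveC hdg, hinv₁, add_neg_cancel]

/-- UNIQUENESS: any configuration with free part `a` solving the constraint IS `C a` (given `Qd⁻¹ ∘ Qd = id` and that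
a configuration is recovered from its parts) — «The equation determines the variable A′(b₀(c))».
[cite: Balaban1988Convergent, p.249 (def. of C)] -/
theorem solveC_unique (hQt : ∀ ω x, Qt ω x = Qf ω (res x) + Qd ω (dep x))
    (hglue : ∀ x, glue (res x) (dep x) = x) (hinv₂ : ∀ ω d, QdInv ω (Qd ω d) = d)
    (ω : Ω) (a : E) {x : F} (hx : res x = a) (h0 : Qt ω x = 0) : x = solveC glue Qf QdInv ω a := by
  rw [hQt, hx] at h0
  have hd : dep x = QdInv ω (-Qf ω a) := by
    rw [← hinv₂ ω (dep x), eq_neg_of_add_eq_zero_right h0]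
  rw [solveC_apply, ← hd, ← hx, hglue]

/-- HENCE `C` IS COVARIANT whenever the full constraint `Qt` is a covariant family (the printed Q̃ = Q(U₁), whose
covariance under (1.17) is a HYPOTHESIS here, not proved) and `res` intertwines — by
`opCovariant_of_constraint`; no hypothesis on the pieces `Qf`, `Qd`, `QdInv` beyond the algebraic ones.
[cite: Balaban1988Convergent, (1.17) p.250] -/
theorem opCovariant_solveC (hυ : ∀ g, υ g (0 : W) = 0) (hres : ∀ g x, res (τ g x) = σ g (res x))
    (hQ : OpCovariant ρ τ υ Qt) (hQt : ∀ ω x, Qt ω x = Qf ω (res x) + Qd ω (dep x))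
    (hrg : ∀ a d, res (glue a d) = a) (hdg : ∀ a d, dep (glue a d) = d) (hglue : ∀ x, glue (res x) (dep x) = x)
    (hinv₁ : ∀ ω w, Qd ω (QdInv ω w) = w) (hinv₂ : ∀ ω d, QdInv ω (Qd ω d) = d) :
    OpCovariant ρ σ τ (solveC glue Qf QdInv) :=
  opCovariant_of_constraint hυ hres hQ (res_solveC hrg) (constraint_solveC hQt hrg hdg hinv₁)
    (fun ω a _ hx h0 => solveC_unique hQt hglue hinv₂ ω a hx h0)

/-- `C` IS ADDITIVE («a linear function of the remaining variables») when the pieces are. [folklore] -/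
theorem solveC_add [Add E] [Add D] [Add F]
    (hglue : ∀ a a' d d', glue (a + a') (d + d') = glue a d + glue a' d')
    (hQf : ∀ ω a a', Qf ω (a + a') = Qf ω a + Qf ω a')
    (hQdInv : ∀ ω w w', QdInv ω (w + w') = QdInv ω w + QdInv ω w') (ω : Ω) (a a' : E) :
    solveC glue Qf QdInv ω (a + a') = solveC glue Qf QdInv ω a + solveC glue Qf QdInv ω a' := by
  rw [solveC_apply, solveC_apply, solveC_apply, ← hglue, ← hQdInv, hQf, neg_add]

/-- `C` IS HOMOGENEOUS when the pieces are. [folklore] -/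
theorem solveC_smul {𝕜 : Type*} [SMul 𝕜 E] [SMul 𝕜 D] [SMul 𝕜 F] [Monoid 𝕜] [DistribMulAction 𝕜 W]
    (hglue : ∀ (c : 𝕜) a d, glue (c • a) (c • d) = c • glue a d)
    (hQf : ∀ ω (c : 𝕜) a, Qf ω (c • a) = c • Qf ω a)
    (hQdInv : ∀ ω (c : 𝕜) w, QdInv ω (c • w) = c • QdInv ω w) (ω : Ω) (c : 𝕜) (a : E) :
    solveC glue Qf QdInv ω (c • a) = c • solveC glue Qf QdInv ω a := by
  rw [solveC_apply, solveC_apply, ← hglue, ← hQdInv, hQf, smul_neg]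

end Elimination

end Abstract

/-! ## §2  Lattice level: the coordinate splitting along the free set Ω₁*, the one-bond-per-cube dependent block -/

section Lattice

variable {G : Type*} {ι : Type*} {V : Type*}

section Split

/-- THE FREE COORDINATES of a field: restriction to `S` («we denote by A the integration variables restricted to
bonds Ω₁* = Ω₁∖{b₀(c) : c∈Ω₁⁽¹⁾}»). [cite: Balaban1988Convergent, p.249 (Ω₁*)] -/
def freePart (S : Set ι) (x : ι → V) : ↥S → V := fun i => x i

/-- THE DEPENDENT COORDINATES: restriction to the complement of `S` (the bonds b₀(c)). [folklore] -/
def depPart (S : Set ι) (x : ι → V) : {i // i ∉ S} → V := fun i => x i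

/-- REASSEMBLING a field from its free and dependent coordinates. [folklore] -/
def glueParts (S : Set ι) [DecidablePred (· ∈ S)] (a : ↥S → V) (d : {i // i ∉ S} → V) : ι → V :=
  fun i => if h : i ∈ S then a ⟨i, h⟩ else d ⟨i, h⟩

/-- `freePart` on a coordinate. [folklore] -/
@[simp] theorem freePart_apply (S : Set ι) (x : ι → V) (i : ↥S) : freePart S x i = x i := rfl

/-- `depPart` on a coordinate. [folklore] -/
@[simp] theorem depPart_apply (S : Set ι) (x : ι → V) (i : {i // i ∉ S}) : depPart S x i = x i := rfl

variable (S : Set ι) [DecidablePred (· ∈ S)]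

/-- `glueParts` on a free coordinate. [folklore] -/
@[simp] theorem glueParts_apply_mem (a : ↥S → V) (d : {i // i ∉ S} → V) {i : ι} (h : i ∈ S) :
    glueParts S a d i = a ⟨i, h⟩ := by
  simp only [glueParts, dif_pos h]

/-- `glueParts` on a dependent coordinate. [folklore] -/
@[simp] theorem glueParts_apply_not_mem (a : ↥S → V) (d : {i // i ∉ S} → V) {i : ι} (h : i ∉ S) :
    glueParts S a d i = d ⟨i, h⟩ := by
  simp only [glueParts, dif_neg h]

/-- free ∘ glue = first argument. [folklore] -/
@[simp] theorem freePart_glueParts (a : ↥S → V) (d : {i // i ∉ S} → V) : freePart S (glueParts S a d) = a := by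
  funext i; simp [i.2]

/-- dep ∘ glue = second argument. [folklore] -/
@[simp] theorem depPart_glueParts (a : ↥S → V) (d : {i // i ∉ S} → V) : depPart S (glueParts S a d) = d := by
  funext i; simp [i.2]

/-- glue ∘ (free, dep) = id: a configuration is recovered from its parts. [folklore] -/
@[simp] theorem glueParts_freePart_depPart (x : ι → V) : glueParts S (freePart S x) (depPart S x) = x := by
  funext i
  by_cases h : i ∈ S
  · simp [h]
  · simp [h]

end Split

section SplitAdd

variable [NormedAddCommGroup V] (S : Set ι) [DecidablePred (· ∈ S)]

/-- `glueParts` is additive in the pair. [folklore] -/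
theorem glueParts_add (a a' : ↥S → V) (d d' : {i // i ∉ S} → V) :
    glueParts S (a + a') (d + d') = glueParts S a d + glueParts S a' d' := by
  funext i
  by_cases h : i ∈ S
  · simp [h]
  · simp [h]

/-- RESTRICTION TO THE REGION kills the dependent part: Λ₁(glue a d) = glue a 0 (extension by zero). [folklore] -/
theorem restrictTo_glueParts (a : ↥S → V) (d : {i // i ∉ S} → V) :
    restrictTo S (glueParts S a d) = glueParts S a 0 := by
  funext i
  by_cases h : i ∈ S
  · simp [restrictTo, h]
  · simp [restrictTo, h]

/-- `restrictTo S x` («Λ₁A») is the free part of `x` extended by zero. [folklore] -/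
theorem restrictTo_eq_glueParts (x : ι → V) : restrictTo S x = glueParts S (freePart S x) 0 := by
  rw [← restrictTo_glueParts S (freePart S x) (depPart S x), glueParts_freePart_depPart]

/-- The free part of `Λ₁x` is the free part of `x`. [folklore] -/
theorem freePart_restrictTo (x : ι → V) : freePart S (restrictTo S x) = freePart S x := by
  rw [restrictTo_eq_glueParts, freePart_glueParts]

end SplitAdd

section SplitAd

variable [NormedAddCommGroup V] [InnerProductSpace ℝ V] (S : Set ι)

/-- `freePart` intertwines the constant adjoint actions (on `ι` and on `↥S`). [folklore] -/
theorem freePart_adAct (Ad : G → V ≃ₗᵢ[ℝ] V) (g : G) (x : ι → V) :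
    freePart S (adAct Ad g x) = adAct Ad g (freePart S x) := rfl

/-- `depPart` intertwines the constant adjoint actions. [folklore] -/
theorem depPart_adAct (Ad : G → V ≃ₗᵢ[ℝ] V) (g : G) (x : ι → V) :
    depPart S (adAct Ad g x) = adAct Ad g (depPart S x) := rfl

variable [DecidablePred (· ∈ S)]

/-- `glueParts` is homogeneous in the pair. [folklore] -/
theorem glueParts_smul (c : ℝ) (a : ↥S → V) (d : {i // i ∉ S} → V) :
    glueParts S (c • a) (c • d) = c • glueParts S a d := by
  funext i
  by_cases h : i ∈ S
  · simp [h]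
  · simp [h]

/-- `glueParts` intertwines the constant adjoint actions. [folklore] -/
theorem glueParts_adAct (Ad : G → V ≃ₗᵢ[ℝ] V) (g : G) (a : ↥S → V) (d : {i // i ∉ S} → V) :
    glueParts S (adAct Ad g a) (adAct Ad g d) = adAct Ad g (glueParts S a d) := by
  funext i
  by_cases h : i ∈ S
  · simp [h]
  · simp [h]

/-- Extension by zero intertwines the constant adjoint actions (R(u)0 = 0). [folklore] -/
theorem glueParts_zero_adAct (Ad : G → V ≃ₗᵢ[ℝ] V) (g : G) (a : ↥S → V) :
    glueParts S (adAct Ad g a) 0 = adAct Ad g (glueParts S a 0) := by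
  have h0 : adAct Ad g (0 : {i // i ∉ S} → V) = 0 := by funext i; simp
  rw [← glueParts_adAct S Ad g a 0, h0]

end SplitAd

/-! ### The dependent block: one dependent bond `b₀(c)` per cube `c`, with an invertible coefficient -/

section DepBlock

variable [NormedAddCommGroup V] [InnerProductSpace ℝ V] (S : Set ι) {K : Type*} {Ω : Type*}

/-- THE DEPENDENT BLOCK of the linearised constraint: cube `c` reads its own dependent bond `e c = b₀(c)` through an
invertible coefficient `M ω c` («Let us denote by b₀(c) the bond b∈B(c) and contained in c»; the c-th equation
«determines the variable A′(b₀(c))»).  The bijection `e : K ≃ {i // i ∉ S}` is the map c ↦ b₀(c) onto Ω₁∖Ω₁*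
(reading (R1)). [cite: Balaban1985UV3, p.260 (b₀(c))] -/
def depBlock (e : K ≃ {i // i ∉ S}) (M : Ω → K → (V ≃ₗ[ℝ] V)) (ω : Ω) (d : {i // i ∉ S} → V) : K → V :=
  fun c => M ω c (d (e c))

/-- ITS INVERSE, cube by cube: d(b₀(c)) = M(c)⁻¹ w(c). [folklore] -/
def depBlockInv (e : K ≃ {i // i ∉ S}) (M : Ω → K → (V ≃ₗ[ℝ] V)) (ω : Ω) (w : K → V) : {i // i ∉ S} → V :=
  fun j => (M ω (e.symm j)).symm (w (e.symm j))

variable (e : K ≃ {i // i ∉ S}) (M : Ω → K → (V ≃ₗ[ℝ] V))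

/-- `depBlock` on a cube. [folklore] -/
@[simp] theorem depBlock_apply (ω : Ω) (d : {i // i ∉ S} → V) (c : K) : depBlock S e M ω d c = M ω c (d (e c)) :=
  rfl

/-- `depBlockInv` on a dependent bond. [folklore] -/
@[simp] theorem depBlockInv_apply (ω : Ω) (w : K → V) (j : {i // i ∉ S}) :
    depBlockInv S e M ω w j = (M ω (e.symm j)).symm (w (e.symm j)) := rfl

/-- `Qd ∘ Qd⁻¹ = id`. [folklore] -/
@[simp] theorem depBlock_depBlockInv (ω : Ω) (w : K → V) : depBlock S e M ω (depBlockInv S e M ω w) = w := by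
  funext c
  simp only [depBlock_apply, depBlockInv_apply, Equiv.symm_apply_apply, LinearEquiv.apply_symm_apply]

/-- `Qd⁻¹ ∘ Qd = id`. [folklore] -/
@[simp] theorem depBlockInv_depBlock (ω : Ω) (d : {i // i ∉ S} → V) :
    depBlockInv S e M ω (depBlock S e M ω d) = d := by
  funext j
  simp only [depBlockInv_apply, depBlock_apply, Equiv.apply_symm_apply, LinearEquiv.symm_apply_apply]

/-- `Qd⁻¹` is additive. [folklore] -/
theorem depBlockInv_add (ω : Ω) (w w' : K → V) :
    depBlockInv S e M ω (w + w') = depBlockInv S e M ω w + depBlockInv S e M ω w' := by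
  funext j; simp

/-- `Qd⁻¹` is homogeneous. [folklore] -/
theorem depBlockInv_smul (ω : Ω) (c : ℝ) (w : K → V) :
    depBlockInv S e M ω (c • w) = c • depBlockInv S e M ω w := by
  funext j; simp

/-- THE LINEARISED AXIAL CONSTRAINT in split form (reading (R1)): `(Q̃x)(c) = (Q_f x|_{Ω₁*})(c) + M(c)·x(b₀(c))`, with
`Qf ω` the (background-dependent) constraint applied to the free variables — the shape of «(Q̃A′)(c) = 0 on Ω₁⁽¹⁾»
with Q̃ the linear averaging operator «defined by (124) [4]»; `Qf` is NOT constructed here.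
[cite: Balaban1988Convergent, p.249 (def. of C)] -/
def linConstraint (Qf : Ω → (↥S → V) → (K → V)) (ω : Ω) (x : ι → V) : K → V :=
  Qf ω (freePart S x) + depBlock S e M ω (depPart S x)

variable [DecidablePred (· ∈ S)]

/-- THE MAP `C` OF B14 p. 249 for the split constraint: free variables on Ω₁* ↦ the full configuration A′ = CA.
[cite: Balaban1988Convergent, p.249 (def. of C)] -/
def axialC (Qf : Ω → (↥S → V) → (K → V)) : Ω → (↥S → V) → (ι → V) :=
  solveC (glueParts S) Qf (depBlockInv S e M)

variable (Qf : Ω → (↥S → V) → (K → V))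

/-- `C a` on a free bond is `a` («A′ = CA» extends A). [cite: Balaban1988Convergent, p.249 (def. of C)] -/
theorem freePart_axialC (ω : Ω) (a : ↥S → V) : freePart S (axialC S e M Qf ω a) = a :=
  res_solveC (res := freePart S) (freePart_glueParts S) ω a

/-- `C a` on the dependent bond b₀(c) is `−M(c)⁻¹ (Q_f a)(c)` — «a linear function of the remaining variables».
[cite: Balaban1988Convergent, p.249 (def. of C)] -/
theorem axialC_apply_dep (ω : Ω) (a : ↥S → V) (c : K) :
    axialC S e M Qf ω a (e c) = -(M ω c).symm (Qf ω a c) := by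
  have h := congrFun (dep_solveC (dep := depPart S) (glue := glueParts S) (Qf := Qf) (QdInv := depBlockInv S e M)
    (depPart_glueParts S) ω a) (e c)
  simp only [depPart_apply, depBlockInv_apply, Equiv.symm_apply_apply, Pi.neg_apply, map_neg] at h
  exact h

/-- «we have Q̃CA = 0». [cite: Balaban1988Convergent, p.249 (def. of C)] -/
theorem linConstraint_axialC (ω : Ω) (a : ↥S → V) : linConstraint S e M Qf ω (axialC S e M Qf ω a) = 0 :=
  constraint_solveC (Qt := linConstraint S e M Qf) (res := freePart S) (dep := depPart S) (Qd := depBlock S e M)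
    (glue := glueParts S) (QdInv := depBlockInv S e M)
    (fun _ _ => rfl) (freePart_glueParts S) (depPart_glueParts S) (depBlock_depBlockInv S e M) ω a

/-- UNIQUENESS: a configuration with free part `a` and Q̃x = 0 is `C a` («The equation determines the variable
A′(b₀(c))»). [cite: Balaban1988Convergent, p.249 (def. of C)] -/
theorem axialC_unique (ω : Ω) (a : ↥S → V) {x : ι → V} (hx : freePart S x = a)
    (h0 : linConstraint S e M Qf ω x = 0) : x = axialC S e M Qf ω a :=
  solveC_unique (Qt := linConstraint S e M Qf) (res := freePart S) (dep := depPart S) (Qd := depBlock S e M)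
    (glue := glueParts S) (QdInv := depBlockInv S e M)
    (fun _ _ => rfl) (glueParts_freePart_depPart S) (depBlockInv_depBlock S e M) ω a hx h0

/-- EXISTENCE AND UNIQUENESS packaged: every free datum has exactly one extension solving the split constraint.
[cite: Balaban1988Convergent, p.249 (def. of C)] -/
theorem existsUnique_linConstraint (ω : Ω) (a : ↥S → V) :
    ∃! x : ι → V, freePart S x = a ∧ linConstraint S e M Qf ω x = 0 :=
  ⟨axialC S e M Qf ω a, ⟨freePart_axialC S e M Qf ω a, linConstraint_axialC S e M Qf ω a⟩,
    fun _ hx => axialC_unique S e M Qf ω a hx.1 hx.2⟩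

/-- `C` IS LINEAR (additive) when `Q_f(ω)` is. [cite: Balaban1988Convergent, p.249 (def. of C)] -/
theorem axialC_add (hQf : ∀ ω a a', Qf ω (a + a') = Qf ω a + Qf ω a') (ω : Ω) (a a' : ↥S → V) :
    axialC S e M Qf ω (a + a') = axialC S e M Qf ω a + axialC S e M Qf ω a' :=
  solveC_add (glueParts_add S) hQf (depBlockInv_add S e M) ω a a'

/-- `C` IS LINEAR (homogeneous) when `Q_f(ω)` is. [cite: Balaban1988Convergent, p.249 (def. of C)] -/
theorem axialC_smul (hQf : ∀ ω (c : ℝ) a, Qf ω (c • a) = c • Qf ω a) (ω : Ω) (c : ℝ) (a : ↥S → V) :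
    axialC S e M Qf ω (c • a) = c • axialC S e M Qf ω a :=
  solveC_smul (glueParts_smul S) hQf (depBlockInv_smul S e M) ω c a

/-- `C` IS COVARIANT, C(U₁^u)R(u)A = R(u)C(U₁)A, GIVEN that the full linearised constraint Q̃ = Q̃(U₁) is a
covariant family for the simultaneous transformation (1.17) (hypothesis `hQ`; in print the covariance of the
averaging operations) — by uniqueness (`opCovariant_of_constraint`). [cite: Balaban1988Convergent, (1.17) p.250] -/
theorem opCovariant_axialC (ρ : G → Ω → Ω) (Ad : G → V ≃ₗᵢ[ℝ] V)
    (hQ : OpCovariant ρ (adAct Ad (ι := ι)) (adAct Ad (ι := K)) (linConstraint S e M Qf)) :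
    OpCovariant ρ (adAct Ad (ι := ↥S)) (adAct Ad (ι := ι)) (axialC S e M Qf) :=
  opCovariant_of_constraint (υ := adAct Ad (ι := K)) (fun g => by funext c; simp) (freePart_adAct S Ad)
    hQ (freePart_axialC S e M Qf) (linConstraint_axialC S e M Qf)
    (fun ω a _ hx h0 => axialC_unique S e M Qf ω a hx h0)

end DepBlock

/-! ## §3  The operator of an invariant quadratic form is covariant: Δ₁ of (1.16), «(3.30) or …»; the word C*Δ₁C -/

section Pairing

variable [NormedAddCommGroup V] [InnerProductSpace ℝ V] [Fintype ι]

/-- The pairing is additive on the left. [folklore] -/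
theorem pairSum_add_left (A B C : ι → V) : pairSum (A + B) C = pairSum A C + pairSum B C := by
  unfold pairSum
  simp only [Pi.add_apply, inner_add_left, Finset.sum_add_distrib]

/-- The pairing is additive on the right. [folklore] -/
theorem pairSum_add_right (A B C : ι → V) : pairSum A (B + C) = pairSum A B + pairSum A C := by
  unfold pairSum
  simp only [Pi.add_apply, inner_add_right, Finset.sum_add_distrib]

/-- The pairing is symmetric. [folklore] -/
theorem pairSum_comm (A B : ι → V) : pairSum A B = pairSum B A := by
  unfold pairSum
  exact Finset.sum_congr rfl fun i _ => real_inner_comm _ _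

/-- The pairing is homogeneous on the left. [folklore] -/
theorem pairSum_smul_left (c : ℝ) (A B : ι → V) : pairSum (c • A) B = c * pairSum A B := by
  unfold pairSum
  simp only [Pi.smul_apply, real_inner_smul_left, Finset.mul_sum]

/-- The pairing is homogeneous on the right. [folklore] -/
theorem pairSum_smul_right (c : ℝ) (A B : ι → V) : pairSum A (c • B) = c * pairSum A B := by
  rw [pairSum_comm, pairSum_smul_left, pairSum_comm]

/-- The pairing with 0 on the right vanishes. [folklore] -/
@[simp] theorem pairSum_zero_right (A : ι → V) : pairSum A 0 = 0 := by
  unfold pairSum; simp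

/-- The pairing with 0 on the left vanishes. [folklore] -/
@[simp] theorem pairSum_zero_left (A : ι → V) : pairSum 0 A = 0 := by
  unfold pairSum; simp

/-- The pairing is subtractive on the left. [folklore] -/
theorem pairSum_sub_left (A B C : ι → V) : pairSum (A - B) C = pairSum A C - pairSum B C := by
  unfold pairSum
  simp only [Pi.sub_apply, inner_sub_left, Finset.sum_sub_distrib]

/-- The pairing is subtractive on the right. [folklore] -/
theorem pairSum_sub_right (A B C : ι → V) : pairSum A (B - C) = pairSum A B - pairSum A C := by
  unfold pairSum
  simp only [Pi.sub_apply, inner_sub_right, Finset.sum_sub_distrib]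

/-- POLARIZATION for an additive map symmetric w.r.t. the pairing: 2⟨x, Ty⟩ = ⟨x+y, T(x+y)⟩ − ⟨x, Tx⟩ − ⟨y, Ty⟩.
[folklore] -/
theorem pairSum_polarization {T : (ι → V) → (ι → V)} (hadd : ∀ x y, T (x + y) = T x + T y)
    (hsymm : ∀ x y, pairSum x (T y) = pairSum (T x) y) (x y : ι → V) :
    2 * pairSum x (T y) = pairSum (x + y) (T (x + y)) - pairSum x (T x) - pairSum y (T y) := by
  rw [hadd, pairSum_add_left, pairSum_add_right, pairSum_add_right, hsymm y x, pairSum_comm (T y) x]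
  ring

/-- THE OPERATOR OF A JOINTLY INVARIANT QUADRATIC FORM IS COVARIANT — the printed inference «⟨R(u)A, Δ^η(U^u)R(u)A⟩
= ⟨A, Δ^η(U)A⟩, (3.30) or … Δ^η(U^u) = R(u)Δ^η(U)R(u^{−1})» read LEFT TO RIGHT, for any additive family symmetric
w.r.t. the pairing: invariance of (ω, a) ↦ ⟨a, T(ω)a⟩ under the simultaneous transformation gives
T(U^u)R(u) = R(u)T(U) (polarization, invariance of the pairing, separation).  For Δ₁ of (1.16): the right-hand side
«⟨A, ΔA⟩ − 2⟨hC⁽²⁾(A), J₁⟩ + 𝐆⁽²⁾(A)» is invariant by the sentence after (1.16) (pointer (P1) of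
`T4AdjointCovariance`), so the additive symmetric operator Δ₁ it defines (reading (R2)) is covariant.  One-operator
twin in inner-product typing: `B9Eq333Cov.intertwine_of_quadForm`.
[cite: Balaban1985BackgroundPropagators, (3.30) p.395] -/
theorem opCovariant_of_invariant_quadForm [DecidableEq ι] {Ω : Type*} (ρ : G → Ω → Ω) (Ad : G → V ≃ₗᵢ[ℝ] V)
    {T : Ω → (ι → V) → (ι → V)} (hadd : ∀ ω x y, T ω (x + y) = T ω x + T ω y)
    (hsymm : ∀ ω x y, pairSum x (T ω y) = pairSum (T ω x) y)
    (hq : ∀ g ω a, pairSum (adAct Ad g a) (T (ρ g ω) (adAct Ad g a)) = pairSum a (T ω a)) :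
    OpCovariant ρ (adAct Ad (ι := ι)) (adAct Ad (ι := ι)) T := by
  have key : ∀ g ω x y, pairSum (adAct Ad g x) (T (ρ g ω) (adAct Ad g y)) = pairSum x (T ω y) := by
    intro g ω x y
    have h2 := pairSum_polarization (hadd (ρ g ω)) (hsymm (ρ g ω)) (adAct Ad g x) (adAct Ad g y)
    have hxy : adAct Ad g x + adAct Ad g y = adAct Ad g (x + y) := by
      rw [adAct_eq_adFamily, adFamily_add]
    rw [hxy, hq, hq, hq, ← pairSum_polarization (hadd ω) (hsymm ω)] at h2
    linarith
  refine opCovariant_of_invariant_form (BF := pairSum) (Φ := fun ω x a => pairSum x (T ω a)) (fun _ _ _ => rfl)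
    key (pairSum_adAct Ad) (fun g => ?_) (fun y y' h => pairSum_separating y y' h)
  rw [adAct_eq_adFamily]
  exact adFamily_surjective _

/-- THE PAIRING-ADJOINT (C* of «C*Δ₁C») of a covariant family between field spaces over two index types is
covariant — `OpCovariant.adjoint` with the separation / surjectivity hypotheses discharged for `pairSum` / `adAct`.
[cite: Balaban1988Convergent, (1.15) p.249] -/
theorem opCovariant_pairAdjoint {Ω κ : Type*} [Fintype κ] [DecidableEq κ] (ρ : G → Ω → Ω)
    (Ad : G → V ≃ₗᵢ[ℝ] V) {T : Ω → (κ → V) → (ι → V)} {Ts : Ω → (ι → V) → (κ → V)}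
    (hadj : ∀ ω a f, pairSum (T ω a) f = pairSum a (Ts ω f))
    (hT : OpCovariant ρ (adAct Ad (ι := κ)) (adAct Ad (ι := ι)) T) :
    OpCovariant ρ (adAct Ad (ι := ι)) (adAct Ad (ι := κ)) Ts :=
  OpCovariant.adjoint (BE := pairSum) (BF := pairSum) hadj (pairSum_adAct Ad) (pairSum_adAct Ad)
    (fun g => by rw [adAct_eq_adFamily]; exact adFamily_surjective _) (fun x x' h => pairSum_separating x x' h) hT

/-- THE WORD «C*Δ₁C» of (1.15)/(2.21) is a covariant family on the free-variable space, given C covariant, C* its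
pairing-adjoint and Δ₁ covariant. [cite: Balaban1988Convergent, (1.15) p.249] -/
theorem opCovariant_CstarDeltaC {Ω κ : Type*} [Fintype κ] [DecidableEq κ] (ρ : G → Ω → Ω)
    (Ad : G → V ≃ₗᵢ[ℝ] V) {C : Ω → (κ → V) → (ι → V)} {Cs : Ω → (ι → V) → (κ → V)}
    {Δ₁ : Ω → (ι → V) → (ι → V)} (hC : OpCovariant ρ (adAct Ad (ι := κ)) (adAct Ad (ι := ι)) C)
    (hadj : ∀ ω a f, pairSum (C ω a) f = pairSum a (Cs ω f))
    (hΔ : OpCovariant ρ (adAct Ad (ι := ι)) (adAct Ad (ι := ι)) Δ₁) :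
    OpCovariant ρ (adAct Ad (ι := κ)) (adAct Ad (ι := κ)) (fun ω a => Cs ω (Δ₁ ω (C ω a))) :=
  (opCovariant_pairAdjoint ρ Ad hadj hC).comp (hΔ.comp hC)

end Pairing

/-! ## §4  The conditional covariance `C^{(0)}(Λ)`: the inverse of the Λ-block of a strictly positive covariant
symmetric family exists, is covariant and symmetric; the completed square of (1.26) -/

section Block

variable [NormedAddCommGroup V] [InnerProductSpace ℝ V] (Λ : Set ι) {Ω : Type*}

/-- RESTRICTION to the region as a linear map `(ι → V) →ₗ (↥Λ → V)`. [folklore] -/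
def resLin : (ι → V) →ₗ[ℝ] (↥Λ → V) where
  toFun x := freePart Λ x
  map_add' _ _ := rfl
  map_smul' _ _ := rfl

/-- `resLin` is `freePart`. [folklore] -/
@[simp] theorem resLin_apply (x : ι → V) : resLin Λ x = freePart Λ x := rfl

variable [DecidablePred (· ∈ Λ)]

/-- EXTENSION BY ZERO as a linear map `(↥Λ → V) →ₗ (ι → V)`. [folklore] -/
def extLin : (↥Λ → V) →ₗ[ℝ] (ι → V) where
  toFun a := glueParts Λ a 0
  map_add' a b := by
    have h := glueParts_add Λ a b 0 0
    rwa [add_zero] at h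
  map_smul' c a := by
    have h := glueParts_smul Λ c a 0
    rwa [smul_zero] at h

/-- `extLin` is `glueParts · 0`. [folklore] -/
@[simp] theorem extLin_apply (a : ↥Λ → V) : extLin Λ a = glueParts Λ a 0 := rfl

/-- THE Λ-BLOCK `M(ω) = Λ X(ω) Λ` of a linear operator family, as an endomorphism of the Λ-supported fields — the
operator of the quadratic form «−½⟨Λ₁A, C*Δ₁CΛ₁A⟩» of (1.26) with X = C*Δ₁C.
[cite: Balaban1988Convergent, (1.26) p.253] -/
def blockOp (X : Ω → (ι → V) →ₗ[ℝ] (ι → V)) (ω : Ω) : (↥Λ → V) →ₗ[ℝ] (↥Λ → V) :=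
  (resLin Λ).comp ((X ω).comp (extLin Λ))

/-- `blockOp` on an argument. [folklore] -/
theorem blockOp_apply (X : Ω → (ι → V) →ₗ[ℝ] (ι → V)) (ω : Ω) (a : ↥Λ → V) :
    blockOp Λ X ω a = freePart Λ (X ω (glueParts Λ a 0)) := rfl

/-- THE BLOCK IS COVARIANT for the adjoint action on Λ-fields, given X covariant. [folklore] -/
theorem opCovariant_blockOp (ρ : G → Ω → Ω) (Ad : G → V ≃ₗᵢ[ℝ] V) {X : Ω → (ι → V) →ₗ[ℝ] (ι → V)}
    (hX : OpCovariant ρ (adAct Ad (ι := ι)) (adAct Ad (ι := ι)) (fun ω => ⇑(X ω))) :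
    OpCovariant ρ (adAct Ad (ι := ↥Λ)) (adAct Ad (ι := ↥Λ)) (fun ω => ⇑(blockOp Λ X ω)) := by
  intro g ω a
  have h1 : X (ρ g ω) (adAct Ad g (glueParts Λ a 0)) = adAct Ad g (X ω (glueParts Λ a 0)) := hX g ω _
  show freePart Λ (X (ρ g ω) (glueParts Λ (adAct Ad g a) 0)) = adAct Ad g (freePart Λ (X ω (glueParts Λ a 0)))
  rw [glueParts_zero_adAct, h1, freePart_adAct]

variable [Fintype ι]

/-- Pairing a zero-extension on the left reduces to the block pairing. [folklore] -/
theorem pairSum_glueParts_zero_left (a : ↥Λ → V) (B : ι → V) :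
    pairSum (glueParts Λ a 0) B = pairSum a (freePart Λ B) := by
  unfold pairSum
  rw [← Fintype.sum_subtype_add_sum_subtype (· ∈ Λ) (fun i => inner ℝ (glueParts Λ a 0 i) (B i))]
  have h1 : ∀ i : {x // x ∈ Λ}, inner ℝ (glueParts Λ a 0 (i : ι)) (B i) = inner ℝ (a i) (freePart Λ B i) :=
    fun i => by simp [i.2]
  have h2 : ∀ i : {x // ¬ (x ∈ Λ)}, inner ℝ (glueParts Λ a 0 (i : ι)) (B i) = 0 := fun i => by simp [i.2]
  simp only [h1, h2, Finset.sum_const_zero, add_zero]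

/-- … and on the right. [folklore] -/
theorem pairSum_glueParts_zero_right (A : ι → V) (b : ↥Λ → V) :
    pairSum A (glueParts Λ b 0) = pairSum (freePart Λ A) b := by
  rw [pairSum_comm, pairSum_glueParts_zero_left, pairSum_comm]

/-- The quadratic form of the block is the restricted quadratic form of X: ⟨a, M b⟩ = ⟨Λa, XΛb⟩. [folklore] -/
theorem pairSum_blockOp (X : Ω → (ι → V) →ₗ[ℝ] (ι → V)) (ω : Ω) (a b : ↥Λ → V) :
    pairSum a (blockOp Λ X ω b) = pairSum (glueParts Λ a 0) (X ω (glueParts Λ b 0)) := by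
  rw [blockOp_apply, pairSum_glueParts_zero_left]

/-- STRICT POSITIVITY OF THE Λ-BLOCK (hypothesis of the construction: the restricted quadratic form is positive
definite — in print a consequence of the positivity / lower bounds of C*Δ₁C, NOT proved here). [folklore] -/
def BlockPos (X : Ω → (ι → V) →ₗ[ℝ] (ι → V)) : Prop :=
  ∀ ω (a : ↥Λ → V), a ≠ 0 → 0 < pairSum a (blockOp Λ X ω a)

/-- Block positivity follows from strict positivity of X(ω) on all non-zero fields. [folklore] -/
theorem blockPos_of_pos (X : Ω → (ι → V) →ₗ[ℝ] (ι → V))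
    (hpos : ∀ ω (A : ι → V), A ≠ 0 → 0 < pairSum A (X ω A)) : BlockPos Λ X := by
  intro ω a ha
  rw [pairSum_blockOp]
  refine hpos ω _ fun h => ha ?_
  have h' := congrArg (freePart Λ) h
  rwa [freePart_glueParts] at h'

variable {X : Ω → (ι → V) →ₗ[ℝ] (ι → V)}

/-- The block of a pairing-symmetric family is pairing-symmetric. [folklore] -/
theorem blockOp_symm (hXs : ∀ ω x y, pairSum x (X ω y) = pairSum (X ω x) y) (ω : Ω) (a b : ↥Λ → V) :
    pairSum a (blockOp Λ X ω b) = pairSum (blockOp Λ X ω a) b := by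
  rw [pairSum_blockOp, hXs, pairSum_comm, ← pairSum_blockOp, pairSum_comm]

/-- A strictly positive block is injective. [folklore] -/
theorem blockOp_injective (h : BlockPos Λ X) (ω : Ω) : Function.Injective (blockOp Λ X ω) := by
  intro a b hab
  by_contra hne
  have hpos := h ω (a - b) (sub_ne_zero.mpr hne)
  rw [map_sub, hab, sub_self, pairSum_zero_right] at hpos
  exact lt_irrefl 0 hpos

variable [FiniteDimensional ℝ V]

/-- THE CONDITIONAL COVARIANCE ON THE BLOCK, `C^{(0)}(Λ) = (Λ X Λ)^{−1}` on Λ-supported fields: it EXISTS because an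
injective endomorphism of the finite-dimensional space `↥Λ → V` is invertible.  Reading (R3): C^{(0)}(Λ₁) is the
covariance of the Gaussian measure «dμ_{C^{(0)}(Λ₁)}» of (1.26), whose density is the first factor
«exp[−½⟨Λ₁A, C*Δ₁CΛ₁A⟩ …]». [cite: Balaban1988Convergent, (1.26) p.253] -/
noncomputable def blockInv (h : BlockPos Λ X) (ω : Ω) : (↥Λ → V) ≃ₗ[ℝ] (↥Λ → V) :=
  (LinearEquiv.ofInjectiveEndo (blockOp Λ X ω) (blockOp_injective Λ h ω)).symm

/-- M ∘ C^{(0)} = id. [folklore] -/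
@[simp] theorem blockOp_blockInv (h : BlockPos Λ X) (ω : Ω) (w : ↥Λ → V) :
    blockOp Λ X ω (blockInv Λ h ω w) = w :=
  (LinearEquiv.ofInjectiveEndo (blockOp Λ X ω) (blockOp_injective Λ h ω)).apply_symm_apply w

/-- C^{(0)} ∘ M = id. [folklore] -/
@[simp] theorem blockInv_blockOp (h : BlockPos Λ X) (ω : Ω) (a : ↥Λ → V) :
    blockInv Λ h ω (blockOp Λ X ω a) = a :=
  (LinearEquiv.ofInjectiveEndo (blockOp Λ X ω) (blockOp_injective Λ h ω)).symm_apply_apply a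

/-- `C^{(0)}(Λ)` IS COVARIANT: C^{(0)}(Λ)(U₁^u) R(u) = R(u) C^{(0)}(Λ)(U₁) — `OpCovariant.inverse`.
[cite: Balaban1988Convergent, (1.17) p.250] -/
theorem opCovariant_blockInv (ρ : G → Ω → Ω) (Ad : G → V ≃ₗᵢ[ℝ] V)
    (hX : OpCovariant ρ (adAct Ad (ι := ι)) (adAct Ad (ι := ι)) (fun ω => ⇑(X ω))) (h : BlockPos Λ X) :
    OpCovariant ρ (adAct Ad (ι := ↥Λ)) (adAct Ad (ι := ↥Λ)) (fun ω => ⇑(blockInv Λ h ω)) :=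
  OpCovariant.inverse (opCovariant_blockOp Λ ρ Ad hX) (blockOp_blockInv Λ h) (blockInv_blockOp Λ h)

/-- `C^{(0)}(Λ)` IS SYMMETRIC w.r.t. the pairing when X is. [folklore] -/
theorem blockInv_symm (hXs : ∀ ω x y, pairSum x (X ω y) = pairSum (X ω x) y) (h : BlockPos Λ X) (ω : Ω)
    (w w' : ↥Λ → V) : pairSum w (blockInv Λ h ω w') = pairSum (blockInv Λ h ω w) w' := by
  conv_lhs => rw [← blockOp_blockInv Λ h ω w]
  conv_rhs => rw [← blockOp_blockInv Λ h ω w']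
  rw [← blockOp_symm Λ hXs]

/-- `C^{(0)}(Λ)` IS STRICTLY POSITIVE. [folklore] -/
theorem blockInv_pos (h : BlockPos Λ X) (ω : Ω) (w : ↥Λ → V) (hw : w ≠ 0) : 0 < pairSum w (blockInv Λ h ω w) := by
  have ha : blockInv Λ h ω w ≠ 0 := fun h0 => hw (by rw [← blockOp_blockInv Λ h ω w, h0, map_zero])
  have := h ω (blockInv Λ h ω w) ha
  rwa [blockOp_blockInv, pairSum_comm] at this

/-- THE CONDITIONAL COVARIANCE AS AN OPERATOR ON ALL FIELDS, `Λ C^{(0)}(Λ) Λ` (restrict, invert the block, extend by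
zero) — the placement in which it appears inside the words «C*Δ₁CC^{(0)}(Λ₁)C*Δ₁CΛ₁^cA» of (1.26) and
«C*Δ^{(j)}CC^{(j)}(Λ_{j+1})C*Δ^{(j)}C» of (2.21). [cite: Balaban1988Convergent, (1.26) p.253] -/
noncomputable def condCov (h : BlockPos Λ X) (ω : Ω) (B : ι → V) : ι → V :=
  glueParts Λ (blockInv Λ h ω (freePart Λ B)) 0

/-- `condCov` on an argument. [folklore] -/
theorem condCov_apply (h : BlockPos Λ X) (ω : Ω) (B : ι → V) :
    condCov Λ h ω B = glueParts Λ (blockInv Λ h ω (freePart Λ B)) 0 := rfl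

/-- `condCov` is Λ-supported. [folklore] -/
theorem restrictTo_condCov (h : BlockPos Λ X) (ω : Ω) (B : ι → V) :
    restrictTo Λ (condCov Λ h ω B) = condCov Λ h ω B := by
  rw [condCov_apply, restrictTo_glueParts]

/-- `condCov` only sees the Λ-part of its argument. [folklore] -/
theorem condCov_restrictTo (h : BlockPos Λ X) (ω : Ω) (B : ι → V) :
    condCov Λ h ω (restrictTo Λ B) = condCov Λ h ω B := by
  rw [condCov_apply, condCov_apply, freePart_restrictTo]

/-- Λ X C^{(0)}(Λ) = Λ: on Λ, X ∘ condCov reproduces the argument. [folklore] -/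
theorem restrictTo_X_condCov (h : BlockPos Λ X) (ω : Ω) (B : ι → V) :
    restrictTo Λ (X ω (condCov Λ h ω B)) = restrictTo Λ B := by
  rw [restrictTo_eq_glueParts, restrictTo_eq_glueParts Λ B, condCov_apply, ← blockOp_apply, blockOp_blockInv]

/-- C^{(0)}(Λ) X Λ = Λ: condCov inverts X on Λ-supported fields. [folklore] -/
theorem condCov_X_glueParts (h : BlockPos Λ X) (ω : Ω) (a : ↥Λ → V) :
    condCov Λ h ω (X ω (glueParts Λ a 0)) = glueParts Λ a 0 := by
  rw [condCov_apply, ← blockOp_apply, blockInv_blockOp]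

/-- `condCov` IS COVARIANT for the adjoint action on all fields. [cite: Balaban1988Convergent, (1.17) p.250] -/
theorem opCovariant_condCov (ρ : G → Ω → Ω) (Ad : G → V ≃ₗᵢ[ℝ] V)
    (hX : OpCovariant ρ (adAct Ad (ι := ι)) (adAct Ad (ι := ι)) (fun ω => ⇑(X ω))) (h : BlockPos Λ X) :
    OpCovariant ρ (adAct Ad (ι := ι)) (adAct Ad (ι := ι)) (condCov Λ h) := by
  intro g ω B
  have h1 : blockInv Λ h (ρ g ω) (adAct Ad g (freePart Λ B)) = adAct Ad g (blockInv Λ h ω (freePart Λ B)) :=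
    opCovariant_blockInv Λ ρ Ad hX h g ω (freePart Λ B)
  show glueParts Λ (blockInv Λ h (ρ g ω) (freePart Λ (adAct Ad g B))) 0 =
    adAct Ad g (glueParts Λ (blockInv Λ h ω (freePart Λ B)) 0)
  rw [freePart_adAct, h1, glueParts_zero_adAct]

/-- `condCov` IS SYMMETRIC w.r.t. the pairing on all fields when X is. [folklore] -/
theorem condCov_symm (hXs : ∀ ω x y, pairSum x (X ω y) = pairSum (X ω x) y) (h : BlockPos Λ X) (ω : Ω)
    (B B' : ι → V) : pairSum B (condCov Λ h ω B') = pairSum (condCov Λ h ω B) B' := by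
  rw [condCov_apply, condCov_apply, pairSum_glueParts_zero_right, pairSum_glueParts_zero_left,
    blockInv_symm Λ hXs h]

/-- `condCov` is positive semidefinite on all fields. [folklore] -/
theorem condCov_nonneg (h : BlockPos Λ X) (ω : Ω) (B : ι → V) : 0 ≤ pairSum B (condCov Λ h ω B) := by
  rw [condCov_apply, pairSum_glueParts_zero_right]
  by_cases hB : freePart Λ B = 0
  · rw [hB, map_zero, pairSum_zero_right]
  · exact (blockInv_pos Λ h ω _ hB).le

/-- COMPLETING THE SQUARE behind the second equality of (1.26): for a Λ-supported integration field ΛA = glue a 0,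
an arbitrary second field B (the exterior field Λ₁ᶜA in print) and a pairing-symmetric X with strictly positive
Λ-block M = Λ X Λ, C0 = M⁻¹ and j = ΛXB,
  −½⟨ΛA, XΛA⟩ − ⟨B, XΛA⟩ = −½⟨a + C0 j, M(a + C0 j)⟩ + ½⟨B, X·condCov(XB)⟩,
i.e. the Gaussian in the shifted variable times the printed factor «exp[… + ½⟨Λ₁ᶜA, C*Δ₁CC^{(0)}(Λ₁)C*Δ₁CΛ₁ᶜA⟩ …]».
Pure algebra; the Gaussian integration (translation invariance of dA|_{Λ₁}, the normalisation Z^{(0)}(Λ₁)) and the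
definition of 𝐄⁽¹⁾ are NOT formalised (reading (R3)). [cite: Balaban1988Convergent, (1.26) p.253] -/
theorem complete_square (hXs : ∀ ω x y, pairSum x (X ω y) = pairSum (X ω x) y) (h : BlockPos Λ X) (ω : Ω)
    (a : ↥Λ → V) (B : ι → V) :
    -(1 / 2 : ℝ) * pairSum (glueParts Λ a 0) (X ω (glueParts Λ a 0)) - pairSum B (X ω (glueParts Λ a 0)) =
      -(1 / 2 : ℝ) * pairSum (a + blockInv Λ h ω (freePart Λ (X ω B)))
          (blockOp Λ X ω (a + blockInv Λ h ω (freePart Λ (X ω B)))) +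
        (1 / 2 : ℝ) * pairSum B (X ω (condCov Λ h ω (X ω B))) := by
  have hcross : pairSum B (X ω (glueParts Λ a 0)) = pairSum (freePart Λ (X ω B)) a := by
    rw [hXs, pairSum_glueParts_zero_right]
  have hquad : pairSum B (X ω (condCov Λ h ω (X ω B))) =
      pairSum (freePart Λ (X ω B)) (blockInv Λ h ω (freePart Λ (X ω B))) := by
    rw [hXs, condCov_apply, pairSum_glueParts_zero_right]
  have hsq : ∀ j : ↥Λ → V, pairSum (a + blockInv Λ h ω j) (blockOp Λ X ω (a + blockInv Λ h ω j)) =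
      pairSum a (blockOp Λ X ω a) + 2 * pairSum j a + pairSum j (blockInv Λ h ω j) := by
    intro j
    rw [map_add, blockOp_blockInv, pairSum_add_left, pairSum_add_right, pairSum_add_right,
      blockOp_symm Λ hXs ω (blockInv Λ h ω j) a, blockOp_blockInv, pairSum_comm a j,
      pairSum_comm (blockInv Λ h ω j) j]
    ring
  rw [hcross, hquad, hsq, ← pairSum_blockOp]
  ring

end Block

end Lattice

end Literature.MathematicalPhysics.QuantumFieldTheory.Balaban1983to89.T4AdjointCovarianceWords
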